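import Literature.NumberTheory.EllipticCurves.PAdicLFunctionMuInvariantCertificateProofs
import Literature.NumberTheory.EllipticCurves.PAdicLFunctionBranchInterpolationProofs
import Literature.NumberTheory.EllipticCurves.PAdicLFunctionIntegralityAtTwoProofs
import HarnessLib

/-!
# `μ`-invariant certificates for the tame branches `L_p(f, α, ω^i, T)`: a unit value of the measure at
# ONE unit class forces a unit coefficient of SOME branch — an EVEN one for the (even) plus measure
# (theorems only — no definition, no named fact)

Mazur–Tate–Teitelbaum (Invent. Math. 84 (1986), §I.13): the measure `μ_{f,α}` on `ℤ_p^× = μ_τ × Γ`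
has one power series per tame character, `L_p(f, α, ω^i, T) = ∫ ω^i(x)(1+T)^{ℓ(x)} dμ_{f,α}` (tree:
`padicLFunctionBranch f α i`, coefficients `padicLBranchCoeff f α i k = lim_n padicLBranchRiemannSum f α i k n`,
the `η^i`-weighted Riemann sums; `PAdicLFunctionBranch.lean`), and `ℤ_p⟦ℤ_p^×⟧ = ⊕_i e_i ℤ_p⟦Γ⟧`
(`τ = p − 1` is invertible in `ℤ_p` for odd `p`). Hence for a `ℤ_p`-valued measure:
«`μ_{f,α} ≢ 0 (mod p)` on the unit classes ⟺ SOME branch `L_p(f, α, ω^i)` has `μ`-invariant `0`», and an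
EVEN measure (the plus measure: `μ_{f,α}(−U) = μ_{f,α}(U)`, tree `msdMeasure_neg`) only sees EVEN `i`.
This is the «parity-wise» reading of cell `bsd-f3-mu` (MEMO-an §10.3 (c), §10.4): the measure as a whole
decides «some even branch», never a chosen branch. This file PROVES it in the kernel on top of
`PAdicLFunctionMuInvariantCertificateProofs` (Newton inversion + uniform Lucas bound) and the tree's
twisted family `branchTwist i μ` (`PAdicMeasureTransformBranches`):

* `finsum_branchTwist_classMap_eq` — the Teichmüller-orbit sums of `ω^i μ` are the `η^i`-weighted orbit
  sums `ν^{(i)}_n(s) = ∑_η η^i μ(η γˢ + p^{n+e₀}ℤ_p)`;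
* `exists_lt_norm_limUnder_weightedRiemannSum_of_lt_norm_branchOrbitSum` — BRANCH CERTIFICATE (abstract):
  `C·p⁻¹ < ‖ν^{(i)}_n(s₀)‖ ⟹ ∃ k < pⁿ, C·p⁻¹ < ‖c^{(i)}_k‖`;
* `exists_lt_norm_branchOrbitSum_of_lt_norm_apply` — ORTHOGONALITY over `μ_τ(ℤ_p)` (`p` odd):
  `C·p⁻¹ < ‖μ(η₀ γ^{s₀} + p^{n+e₀}ℤ_p)‖ ⟹ ∃ i < τ, C·p⁻¹ < ‖ν^{(i)}_n(s₀)‖`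
  (`∑_{i<τ} η₀^{−i} ν^{(i)} = τ·μ(η₀γ^{s₀})`, `‖τ‖_p = 1`);
* `branchOrbitSum_eq_zero_of_odd` — for an EVEN family and odd `i`, `ν^{(i)} = 0` (reindex `η ↦ −η`);
* `exists_even_branch_norm_coeff_eq_one_of_unit_msdMeasure` — for `μ_{f,α}` (`p` odd, distribution
  relation, `ℤ_p`-valued, `|α|_p = 1`): a unit residue `a mod p^{m+1}` with `1 ≤ ‖μ_{f,α}(a + p^{m+1}ℤ_p)‖`
  gives an EVEN `i < p − 1` and a `k` with `‖[Tᵏ] L_p(f, α, ω^i, T)‖ = 1`;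
* `exists_even_branch_norm_coeff_eq_one_of_unit_msdMeasure_of_isNewformOf` — the same for the newform of an
  elliptic curve good ordinary at `p` with `E[p]` irreducible (integrality from the tree).

Use (cell `bsd-print-x9`, seat p2 gen 3, `--supports` crux 19630 `AnalyticMuZeroOnClassX9`): with THEOREM B
(cell bsd-f3-mu / bsd-print-x8: `ConjSpanGen N p` for all levels, modulo (L) Morris 2007 ∧ (C) Serre 1970),
AN-9 (`PrintX8VerticalStevens.cycWindingNonConstancyOddIrreducible_of_conjSpanGenAll`, tree) and the
modular-symbol half of the collapse (`CycWindingNonConstantAt W p ⟹` a unit value of `μ_{f,α}`, bsd-f3-mu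
-an g5 `CollapseThree`, every odd `p`), this gives on class X9 (`p = 5, 7`): «for every X9 pair SOME EVEN
branch of `L_p(E)` has `μ = 0`» — `μ(L_5(E)) = 0 ∨ μ(L_5(E, ω²)) = 0` at `p = 5`. It is NOT crux 19630
(the `ω⁰` branch); honest framing in the Summits-side consumer. beyond-print theorem: no for this file
(MTT §I.13 decomposition made kernel); the X9 parity-wise corollary is the -an lens's (MEMO-an §10.0).

## References

* B. Mazur, J. Tate, J. Teitelbaum, *On `p`-adic analogues of the conjectures of Birch and
  Swinnerton-Dyer*, Invent. Math. 84 (1986), §I.10 (10.1), §I.11–I.13.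
* R. Greenberg, V. Vatsal, *On the Iwasawa invariants of elliptic curves*, Invent. Math. 142 (2000),
  §3, Prop. (3.7) (branches `L(E/ℚ, χ, T)`, `χ` tame).
* L. C. Washington, *Introduction to cyclotomic fields*, GTM 83, §5.1, §7.2.
-/

noncomputable section

open Filter Topology
open scoped MatrixGroups ModularForm
open CongruenceSubgroup Literature.NumberTheory.EllipticCurves.ModularForms

namespace Literature.NumberTheory.EllipticCurves

variable {p : ℕ} [Fact p.Prime]

/-! ### §1 Abstract: the orbit sums of the twisted family, the branch certificate, orthogonality -/

section Abstract

variable {μ : (n : ℕ) → ZMod (p ^ n) → ℚ_[p]}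

/-- The Teichmüller-orbit sums of the twisted family `ω^i μ` are the `ξ^i`-weighted orbit sums of `μ`:
`∑_ξ (ω^i μ)(ξ γˢ + p^{n+e₀}ℤ_p) = ∑_ξ ξ^i μ(ξ γˢ + p^{n+e₀}ℤ_p)` (`branchTwist_apply_of_distribution`,
`teichWeight_classMap`). [cite: MazurTateTeitelbaum1986Invent, §I.13] -/
theorem finsum_branchTwist_classMap_eq
    (hdist : ∀ (n : ℕ) (a : ZMod (p ^ n)),
      ∑ b ∈ Finset.univ.filter (fun b : ZMod (p ^ (n + 1)) ↦
        ZMod.castHom (pow_dvd_pow p n.le_succ) (ZMod (p ^ n)) b = a), μ (n + 1) b = μ n a)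
    (i n : ℕ) (s : ZMod (p ^ n)) :
    (∑ᶠ ξ : rootsOfUnity (torsionOrder p) ℤ_[p],
        branchTwist i μ (n + cyclotomicExponent p)
          (PadicInt.toZModPow (n + cyclotomicExponent p) ((ξ : ℤ_[p]ˣ) : ℤ_[p]) *
            (cyclotomicGenerator p : ZMod (p ^ (n + cyclotomicExponent p))) ^ s.val)) =
      ∑ᶠ ξ : rootsOfUnity (torsionOrder p) ℤ_[p], (((ξ : ℤ_[p]ˣ) : ℤ_[p]) : ℚ_[p]) ^ i *
        μ (n + cyclotomicExponent p)
          (PadicInt.toZModPow (n + cyclotomicExponent p) ((ξ : ℤ_[p]ˣ) : ℤ_[p]) *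
            (cyclotomicGenerator p : ZMod (p ^ (n + cyclotomicExponent p))) ^ s.val) := by
  refine finsum_congr fun ξ ↦ ?_
  rw [branchTwist_apply_of_distribution hdist i (Nat.le_add_left _ n), teichWeight_classMap p i n ξ s,
    mul_comm]

/-- **Branch certificate, abstract form.** For a distribution `μ` bounded by `C` and the `ξ^i`-weighted
Riemann sums `RS(k,n) = ∑_ξ ξ^i ∑_s μ(ξγˢ + p^{n+e₀}ℤ_p)(s choose k)` (those of `L_p(·, ω^i)`): if ONE
weighted orbit sum beats `C·p⁻¹`, `C·p⁻¹ < ‖∑_ξ ξ^i μ(ξ γ^{s₀} + p^{n+e₀}ℤ_p)‖`, then some coefficient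
`c^{(i)}_k = lim_m RS(k,m)`, `k < pⁿ`, has `C·p⁻¹ < ‖c^{(i)}_k‖` — the certificate of
`PAdicLFunctionMuInvariantCertificateProofs` for the twisted family `ω^i μ`.
[cite: MazurTateTeitelbaum1986Invent, §I.11–I.13] -/
theorem exists_lt_norm_limUnder_weightedRiemannSum_of_lt_norm_branchOrbitSum {i : ℕ}
    {RS : ℕ → ℕ → ℚ_[p]}
    (hRS : ∀ k n : ℕ, RS k n =
      ∑ᶠ ζ : rootsOfUnity (torsionOrder p) ℤ_[p], ∑ s : ZMod (p ^ n),
        ((((ζ : ℤ_[p]ˣ) : ℤ_[p]) : ℚ_[p]) ^ i *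
          μ (n + cyclotomicExponent p)
              (PadicInt.toZModPow (n + cyclotomicExponent p) ((ζ : ℤ_[p]ˣ) : ℤ_[p]) *
                (cyclotomicGenerator p : ZMod (p ^ (n + cyclotomicExponent p))) ^ s.val) *
            ((s.val.choose k : ℕ) : ℚ_[p])))
    (hdist : ∀ (n : ℕ) (a : ZMod (p ^ n)),
      ∑ b ∈ Finset.univ.filter (fun b : ZMod (p ^ (n + 1)) ↦
        ZMod.castHom (pow_dvd_pow p n.le_succ) (ZMod (p ^ n)) b = a), μ (n + 1) b = μ n a)
    {C : ℝ} (hC : ∀ (n : ℕ) (a : ZMod (p ^ n)), ‖μ n a‖ ≤ C) {n : ℕ} {s₀ : ZMod (p ^ n)}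
    (hs₀ : C * (p : ℝ)⁻¹ < ‖∑ᶠ ξ : rootsOfUnity (torsionOrder p) ℤ_[p],
        (((ξ : ℤ_[p]ˣ) : ℤ_[p]) : ℚ_[p]) ^ i * μ (n + cyclotomicExponent p)
          (PadicInt.toZModPow (n + cyclotomicExponent p) ((ξ : ℤ_[p]ˣ) : ℤ_[p]) *
            (cyclotomicGenerator p : ZMod (p ^ (n + cyclotomicExponent p))) ^ s₀.val)‖) :
    ∃ k < p ^ n, C * (p : ℝ)⁻¹ < ‖limUnder atTop fun m ↦ RS k m‖ :=
  exists_lt_norm_limUnder_riemannSum_of_lt_norm_orbitSum (μ := branchTwist i μ) (RS := RS)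
    (fun k m ↦ weightedRiemannSum_eq hRS hdist k m) (branchTwist_distribution hdist i)
    (norm_branchTwist_le hC i) (by rwa [finsum_branchTwist_classMap_eq hdist i n s₀])

/-- **Orthogonality of the tame characters over `μ_τ(ℤ_p)`** (`τ = #μ_τ(ℤ_p)`): for a root of unity
`ξ₀` and a class `s₀`, `∑_{i<τ} ξ₀^{−i}·ν^{(i)}_n(s₀) = τ·μ(ξ₀ γ^{s₀} + p^{n+e₀}ℤ_p)` where
`ν^{(i)}_n(s₀) = ∑_ξ ξ^i μ(ξ γ^{s₀} + p^{n+e₀}ℤ_p)` — the geometric sums `∑_{i<τ} (ξ ξ₀⁻¹)^i` vanish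
for `ξ ≠ ξ₀`. (Washington §5.1; the idempotents `e_i` of `ℤ_p⟦ℤ_p^×⟧`, MTT §I.13.)
[cite: MazurTateTeitelbaum1986Invent, §I.13] -/
theorem sum_pow_inv_mul_branchOrbitSum_eq (L : ℕ) (b : rootsOfUnity (torsionOrder p) ℤ_[p] → ZMod (p ^ L))
    (ξ₀ : rootsOfUnity (torsionOrder p) ℤ_[p]) :
    ∑ i ∈ Finset.range (torsionOrder p), (((ξ₀⁻¹ : rootsOfUnity (torsionOrder p) ℤ_[p]) : ℤ_[p]ˣ) :
        ℤ_[p]) ^ i * (∑ᶠ ξ : rootsOfUnity (torsionOrder p) ℤ_[p],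
          (((ξ : ℤ_[p]ˣ) : ℤ_[p]) : ℚ_[p]) ^ i * μ L (b ξ)) =
      (torsionOrder p : ℚ_[p]) * μ L (b ξ₀) := by
  classical
  haveI := neZero_torsionOrder p
  haveI := Fintype.ofFinite (rootsOfUnity (torsionOrder p) ℤ_[p])
  -- the root of unity `ξ ξ₀⁻¹` as an element of `ℚ_p`, and its geometric sum
  have hgeom : ∀ ξ : rootsOfUnity (torsionOrder p) ℤ_[p],
      ∑ i ∈ Finset.range (torsionOrder p),
        ((((ξ₀⁻¹ : rootsOfUnity (torsionOrder p) ℤ_[p]) : ℤ_[p]ˣ) : ℤ_[p]) : ℚ_[p]) ^ i *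
          (((ξ : ℤ_[p]ˣ) : ℤ_[p]) : ℚ_[p]) ^ i = if ξ = ξ₀ then (torsionOrder p : ℚ_[p]) else 0 := by
    intro ξ
    have hx : ∀ i : ℕ, ((((ξ₀⁻¹ : rootsOfUnity (torsionOrder p) ℤ_[p]) : ℤ_[p]ˣ) : ℤ_[p]) : ℚ_[p]) ^ i *
        (((ξ : ℤ_[p]ˣ) : ℤ_[p]) : ℚ_[p]) ^ i =
        ((((ξ * ξ₀⁻¹ : rootsOfUnity (torsionOrder p) ℤ_[p]) : ℤ_[p]ˣ) : ℤ_[p]) : ℚ_[p]) ^ i := by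
      intro i
      rw [← mul_pow, Subgroup.coe_mul, Units.val_mul, PadicInt.coe_mul, mul_comm]
    simp_rw [hx]
    split_ifs with hξ
    · subst hξ
      simp
    · have hne : (((ξ * ξ₀⁻¹ : rootsOfUnity (torsionOrder p) ℤ_[p]) : ℤ_[p]ˣ) : ℤ_[p]) ≠ 1 := by
        intro h1
        apply hξ
        have h2 : ξ * ξ₀⁻¹ = 1 := Subtype.ext (Units.ext h1)
        exact mul_inv_eq_one.mp h2
      have hne' : ((((ξ * ξ₀⁻¹ : rootsOfUnity (torsionOrder p) ℤ_[p]) : ℤ_[p]ˣ) : ℤ_[p]) : ℚ_[p]) ≠ 1 := by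
        intro h1
        apply hne
        have h1' : ((((ξ * ξ₀⁻¹ : rootsOfUnity (torsionOrder p) ℤ_[p]) : ℤ_[p]ˣ) : ℤ_[p]) : ℚ_[p]) =
            ((1 : ℤ_[p]) : ℚ_[p]) := by rw [h1, PadicInt.coe_one]
        exact Subtype.ext h1'
      rw [geom_sum_eq hne', ← PadicInt.coe_pow, rootsOfUnity_pow_torsionOrder p, PadicInt.coe_one,
        sub_self, zero_div]
  -- swap the sums
  simp only [finsum_eq_sum_of_fintype, Finset.mul_sum]
  rw [Finset.sum_comm]
  have hterm : ∀ ξ : rootsOfUnity (torsionOrder p) ℤ_[p],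
      ∑ i ∈ Finset.range (torsionOrder p),
        ((((ξ₀⁻¹ : rootsOfUnity (torsionOrder p) ℤ_[p]) : ℤ_[p]ˣ) : ℤ_[p]) : ℚ_[p]) ^ i *
          ((((ξ : ℤ_[p]ˣ) : ℤ_[p]) : ℚ_[p]) ^ i * μ L (b ξ)) =
        (if ξ = ξ₀ then (torsionOrder p : ℚ_[p]) else 0) * μ L (b ξ) := by
    intro ξ
    rw [← hgeom ξ, Finset.sum_mul]
    refine Finset.sum_congr rfl fun i _ ↦ ?_
    push_cast
    ring
  rw [Finset.sum_congr rfl fun ξ _ ↦ hterm ξ]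
  simp_rw [ite_mul, zero_mul]
  rw [Finset.sum_ite_eq' Finset.univ ξ₀, if_pos (Finset.mem_univ _)]

/-- **A big value of `μ` at one unit class forces a big weighted orbit sum for SOME tame character**
(`p` odd): if `C·p⁻¹ < ‖μ(ξ₀ γ^{s₀} + p^{n+e₀}ℤ_p)‖` then `C·p⁻¹ < ‖ν^{(i)}_n(s₀)‖` for some `i < τ = p − 1`
— otherwise orthogonality and `‖τ‖_p = 1` would bound `μ(ξ₀ γ^{s₀} + …)` by `C·p⁻¹`.
[cite: MazurTateTeitelbaum1986Invent, §I.13] -/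
theorem exists_lt_norm_branchOrbitSum_of_lt_norm_apply (hp2 : p ≠ 2) {C : ℝ} {n : ℕ}
    (ξ₀ : rootsOfUnity (torsionOrder p) ℤ_[p]) (s₀ : ZMod (p ^ n))
    (h : C * (p : ℝ)⁻¹ < ‖μ (n + cyclotomicExponent p)
        (PadicInt.toZModPow (n + cyclotomicExponent p) ((ξ₀ : ℤ_[p]ˣ) : ℤ_[p]) *
          (cyclotomicGenerator p : ZMod (p ^ (n + cyclotomicExponent p))) ^ s₀.val)‖) :
    ∃ i < torsionOrder p, C * (p : ℝ)⁻¹ < ‖∑ᶠ ξ : rootsOfUnity (torsionOrder p) ℤ_[p],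
        (((ξ : ℤ_[p]ˣ) : ℤ_[p]) : ℚ_[p]) ^ i * μ (n + cyclotomicExponent p)
          (PadicInt.toZModPow (n + cyclotomicExponent p) ((ξ : ℤ_[p]ˣ) : ℤ_[p]) *
            (cyclotomicGenerator p : ZMod (p ^ (n + cyclotomicExponent p))) ^ s₀.val)‖ := by
  classical
  by_contra hcon
  push Not at hcon
  have hp : p.Prime := Fact.out
  -- `‖τ‖_p = 1`
  have hτ : ‖(torsionOrder p : ℚ_[p])‖ = 1 := by
    have hτeq : torsionOrder p = p - 1 := by rw [torsionOrder_eq, if_neg hp2]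
    rw [show (torsionOrder p : ℚ_[p]) = ((torsionOrder p : ℤ) : ℚ_[p]) by norm_cast]
    refine le_antisymm (Padic.norm_int_le_one _) (not_lt.mp fun hlt ↦ ?_)
    have hdvd : (p : ℤ) ∣ (torsionOrder p : ℤ) := Padic.norm_intCast_lt_one_iff.mp hlt
    have hdvd' : p ∣ p - 1 := by rw [← hτeq]; exact_mod_cast hdvd
    have h2 := hp.two_le
    have := Nat.le_of_dvd (by omega) hdvd'
    omega
  -- orthogonality bounds `τ·μ(ξ₀ γ^{s₀})`
  set b : rootsOfUnity (torsionOrder p) ℤ_[p] → ZMod (p ^ (n + cyclotomicExponent p)) := fun ξ ↦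
    PadicInt.toZModPow (n + cyclotomicExponent p) ((ξ : ℤ_[p]ˣ) : ℤ_[p]) *
      (cyclotomicGenerator p : ZMod (p ^ (n + cyclotomicExponent p))) ^ s₀.val with hb_def
  have key := sum_pow_inv_mul_branchOrbitSum_eq (μ := μ) (n + cyclotomicExponent p) b ξ₀
  have hC0 : 0 ≤ C * (p : ℝ)⁻¹ := (norm_nonneg _).trans (hcon 0 (zero_lt_torsionOrder p))
  have hbound : ‖(torsionOrder p : ℚ_[p]) * μ (n + cyclotomicExponent p) (b ξ₀)‖ ≤ C * (p : ℝ)⁻¹ := by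
    rw [← key]
    refine IsUltrametricDist.norm_sum_le_of_forall_le_of_nonneg hC0 fun i hi ↦ ?_
    rw [norm_mul, norm_pow]
    have hunit : ‖((((ξ₀⁻¹ : rootsOfUnity (torsionOrder p) ℤ_[p]) : ℤ_[p]ˣ) : ℤ_[p]) : ℚ_[p])‖ ≤ 1 :=
      PadicInt.norm_le_one _
    calc _ ≤ 1 ^ i * (C * (p : ℝ)⁻¹) :=
          mul_le_mul (pow_le_pow_left₀ (norm_nonneg _) hunit i) (hcon i (Finset.mem_range.mp hi))
            (norm_nonneg _) (by positivity)
      _ = C * (p : ℝ)⁻¹ := by rw [one_pow, one_mul]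
  rw [norm_mul, hτ, one_mul] at hbound
  exact absurd h (not_lt.mpr hbound)

/-- **An even family has vanishing odd-weight orbit sums** (`p` odd): if `μ_L(−b) = μ_L(b)` at level
`L = n + e₀`, then for odd `i` the weighted orbit sum `∑_ξ ξ^i μ(ξ γˢ + p^Lℤ_p)` vanishes (reindex
`ξ ↦ −ξ`, `−1 ∈ μ_{p−1}`). For the plus measure `μ_{f,α}` this is why only EVEN branches `ω^{2j}` live
on `[·]⁺`. [cite: MazurTateTeitelbaum1986Invent, §I.13] -/
theorem branchOrbitSum_eq_zero_of_odd (hp2 : p ≠ 2) {n : ℕ}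
    (heven : ∀ b : ZMod (p ^ (n + cyclotomicExponent p)),
      μ (n + cyclotomicExponent p) (-b) = μ (n + cyclotomicExponent p) b)
    {i : ℕ} (hi : Odd i) (s : ZMod (p ^ n)) :
    (∑ᶠ ξ : rootsOfUnity (torsionOrder p) ℤ_[p], (((ξ : ℤ_[p]ˣ) : ℤ_[p]) : ℚ_[p]) ^ i *
        μ (n + cyclotomicExponent p)
          (PadicInt.toZModPow (n + cyclotomicExponent p) ((ξ : ℤ_[p]ˣ) : ℤ_[p]) *
            (cyclotomicGenerator p : ZMod (p ^ (n + cyclotomicExponent p))) ^ s.val)) = 0 := by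
  classical
  haveI := neZero_torsionOrder p
  haveI := Fintype.ofFinite (rootsOfUnity (torsionOrder p) ℤ_[p])
  -- `ε = −1 ∈ μ_τ(ℤ_p)` (`τ = p − 1` is even)
  have hτeven : Even (torsionOrder p) := by
    rw [torsionOrder_eq, if_neg hp2]
    exact (Fact.out : p.Prime).even_sub_one hp2
  have hε1 : ((-1 : ℤ_[p]ˣ)) ∈ rootsOfUnity (torsionOrder p) ℤ_[p] := by
    rw [mem_rootsOfUnity]
    exact hτeven.neg_one_pow
  set ε : rootsOfUnity (torsionOrder p) ℤ_[p] := ⟨-1, hε1⟩ with hε_def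
  have hεval : (((ε : rootsOfUnity (torsionOrder p) ℤ_[p]) : ℤ_[p]ˣ) : ℤ_[p]) = -1 := by
    rw [hε_def]; rfl
  set F : rootsOfUnity (torsionOrder p) ℤ_[p] → ℚ_[p] := fun ξ ↦ (((ξ : ℤ_[p]ˣ) : ℤ_[p]) : ℚ_[p]) ^ i *
      μ (n + cyclotomicExponent p)
        (PadicInt.toZModPow (n + cyclotomicExponent p) ((ξ : ℤ_[p]ˣ) : ℤ_[p]) *
          (cyclotomicGenerator p : ZMod (p ^ (n + cyclotomicExponent p))) ^ s.val) with hF_def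
  have hF : ∀ ξ, F (ξ * ε) = -F ξ := by
    intro ξ
    simp only [hF_def]
    have h1 : (((ξ * ε : rootsOfUnity (torsionOrder p) ℤ_[p]) : ℤ_[p]ˣ) : ℤ_[p]) =
        -((ξ : ℤ_[p]ˣ) : ℤ_[p]) := by
      rw [Subgroup.coe_mul, Units.val_mul, hεval, mul_neg_one]
    rw [h1, map_neg, neg_mul, heven, PadicInt.coe_neg, Odd.neg_pow hi, neg_mul]
  have hsum : ∑ ξ, F ξ = ∑ ξ, F (ξ * ε) :=
    (Fintype.sum_equiv (Equiv.mulRight ε) _ _ fun ξ ↦ rfl).symm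
  rw [finsum_eq_sum_of_fintype]
  have h2 : (2 : ℚ_[p]) * ∑ ξ, F ξ = 0 := by
    rw [two_mul]
    nth_rw 2 [hsum]
    rw [← Finset.sum_add_distrib]
    exact Finset.sum_eq_zero fun ξ _ ↦ by rw [hF ξ, add_neg_cancel]
  rcases mul_eq_zero.mp h2 with h | h
  · exact absurd h two_ne_zero
  · exact h

end Abstract

/-! ### §2 The Mazur–Swinnerton-Dyer measure: a unit value at one unit class forces a unit coefficient
of an EVEN branch -/

section Elliptic

variable {N : ℕ} [NeZero N] {f : CuspForm (Gamma0 N) 2} {α : ℚ_[p]}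

/-- **A unit value of `μ_{f,α}` forces `μ(L_p(f, α, ω^i)) = 0` for some EVEN `i`** (`p` odd; `μ_{f,α}` a
`ℤ_p`-valued distribution, `|α|_p = 1` not even needed): if `1 ≤ ‖μ_{f,α}(a + p^{m+1}ℤ_p)‖` for a unit
residue `a mod p^{m+1}`, then some `i < p − 1`, `i` even, and some `k` have `‖[Tᵏ] L_p(f, α, ω^i, T)‖ = 1`.
Steps: `a = ξ̄₀ γ^{s₀}` (`exists_coe_eq_toZModPow_mul_pow`); orthogonality gives a tame character with a
unit weighted orbit sum; it is even because the plus measure is even (`msdMeasure_neg`,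
`branchOrbitSum_eq_zero_of_odd`); the branch certificate gives the unit coefficient
(`norm_padicLBranchCoeff_le` for `≤ 1`). [cite: MazurTateTeitelbaum1986Invent, §I.10 (10.1) and §I.13]
[cite: GreenbergVatsal2000, §3 Prop. (3.7)] -/
theorem exists_even_branch_norm_coeff_eq_one_of_unit_msdMeasure (hp2 : p ≠ 2)
    (hdist : ∀ (n : ℕ) (a : ZMod (p ^ n)),
      ∑ b ∈ Finset.univ.filter (fun b : ZMod (p ^ (n + 1)) ↦
        ZMod.castHom (pow_dvd_pow p n.le_succ) (ZMod (p ^ n)) b = a), msdMeasure f α (n + 1) b =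
        msdMeasure f α n a)
    (hint : ∀ (n : ℕ) (a : ZMod (p ^ n)), ‖msdMeasure f α n a‖ ≤ 1) {m : ℕ} {a : ZMod (p ^ (m + 1))}
    (hau : IsUnit a) (ha1 : 1 ≤ ‖msdMeasure f α (m + 1) a‖) :
    ∃ i < p - 1, Even i ∧ ∃ k : ℕ, ‖PowerSeries.coeff k (padicLFunctionBranch f α i)‖ = 1 := by
  classical
  have hp : p.Prime := Fact.out
  have he : cyclotomicExponent p = 1 := by unfold cyclotomicExponent; exact if_neg hp2
  have hτ : torsionOrder p = p - 1 := by rw [torsionOrder_eq, if_neg hp2]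
  -- `a = ξ̄₀ γ^{s₀}`
  obtain ⟨ξ₀, s₀, hξs⟩ := exists_coe_eq_toZModPow_mul_pow hp2 m hau.unit
  rw [hau.unit_spec] at hξs
  -- the measure value at the class, in the `m + e₀` form
  have hbig : (1 : ℝ) * (p : ℝ)⁻¹ < ‖msdMeasure f α (m + cyclotomicExponent p)
      (PadicInt.toZModPow (m + cyclotomicExponent p) ((ξ₀ : ℤ_[p]ˣ) : ℤ_[p]) *
        (cyclotomicGenerator p : ZMod (p ^ (m + cyclotomicExponent p))) ^ s₀.val)‖ := by
    rw [he, ← hξs, one_mul]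
    calc (p : ℝ)⁻¹ < 1 := inv_lt_one_of_one_lt₀ (by exact_mod_cast hp.one_lt)
      _ ≤ _ := ha1
  -- some tame character has a unit weighted orbit sum
  obtain ⟨i, hi, hνi⟩ := exists_lt_norm_branchOrbitSum_of_lt_norm_apply (μ := msdMeasure f α) hp2 ξ₀ s₀
    hbig
  -- it is even
  have hieven : Even i := by
    by_contra hodd
    rw [Nat.not_even_iff_odd] at hodd
    have h0 := branchOrbitSum_eq_zero_of_odd (μ := msdMeasure f α) hp2 (n := m)
      (fun b ↦ msdMeasure_neg f α _ b) hodd s₀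
    rw [h0, norm_zero, one_mul] at hνi
    exact absurd hνi (not_lt.mpr (by positivity))
  -- branch certificate
  obtain ⟨k, -, hk⟩ := exists_lt_norm_limUnder_weightedRiemannSum_of_lt_norm_branchOrbitSum
    (μ := msdMeasure f α) (RS := padicLBranchRiemannSum f α i) (fun _ _ ↦ rfl) hdist hint hνi
  rw [one_mul] at hk
  refine ⟨i, hτ ▸ hi, hieven, k, ?_⟩
  rw [coeff_padicLFunctionBranch]
  exact norm_eq_one_of_inv_lt_of_le_one hk (norm_padicLBranchCoeff_le f α hdist hint i k)

variable {W : WeierstrassCurve ℚ} [W.IsElliptic] [W.IsGloballyMinimal]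

/-- **The same for the newform of an elliptic curve** (`p` odd, `E = W` good ordinary at `p` with `E[p]`
irreducible, `f` a newform of `E`, `α = unitRoot W p`): a unit residue `a mod p^{m+1}` with
`1 ≤ ‖μ_{f,α}(a + p^{m+1}ℤ_p)‖` gives an EVEN `i < p − 1` with a `p`-adic unit coefficient of
`L_p(f, α, ω^i, T)`, i.e. `μ(L_p(E, ω^i)) = 0`. The distribution relation, integrality and `|α|_p = 1` are
the tree theorems `msdMeasure_distribution_of_isNewformOf`, `norm_msdMeasure_le_one` (with
`not_irreducible_of_frobeniusTrace_congr_holds`), `unitRoot_coe_spec`.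
[cite: MazurTateTeitelbaum1986Invent, §I.10 (10.1) and §I.13] [cite: GreenbergVatsal2000, §3 Prop. (3.7)] -/
theorem exists_even_branch_norm_coeff_eq_one_of_unit_msdMeasure_of_isNewformOf (hp2 : p ≠ 2)
    (hord : IsOrdinaryAt W p) (hf : IsNewformOf W f) (hirr : W.HasIrreducibleModPGaloisRep p)
    {m : ℕ} {a : ZMod (p ^ (m + 1))} (hau : IsUnit a)
    (ha1 : 1 ≤ ‖msdMeasure f (unitRoot W p : ℚ_[p]) (m + 1) a‖) :
    ∃ i < p - 1, Even i ∧
      ∃ k : ℕ, ‖PowerSeries.coeff k (padicLFunctionBranch f (unitRoot W p : ℚ_[p]) i)‖ = 1 := by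
  have hdist := msdMeasure_distribution_of_isNewformOf hord hf
  obtain ⟨n₀, hpn₀, h0⟩ :=
    exists_intCast_mul_modularSymbol_zero_mem not_irreducible_of_frobeniusTrace_congr_holds hf hirr
  have hpN : ¬ p ∣ N := not_dvd_level_of_isNewformOf hf hord.1
  have hαu : ‖(unitRoot W p : ℚ_[p])‖ = 1 := (unitRoot_coe_spec (W := W) hord).2.1
  have hint : ∀ (n : ℕ) (b : ZMod (p ^ n)), ‖msdMeasure f (unitRoot W p : ℚ_[p]) n b‖ ≤ 1 :=
    norm_msdMeasure_le_one hp2 hpN hpn₀ h0 hαu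
  exact exists_even_branch_norm_coeff_eq_one_of_unit_msdMeasure hp2 hdist hint hau ha1

end Elliptic

end Literature.NumberTheory.EllipticCurves

end
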